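import Mathlib
import HarnessLib
import Literature.MathematicalPhysics.KineticTheory.HardSphereEulerProofs
import Summits.AtomisticToContinuum.HydrodynamicLimit.Theorems.OneFlightGossipEngineKineticCurrentsWindowLDUniformClassTruncationReduced
import Summits.AtomisticToContinuum.HydrodynamicLimit.Theorems.EquilibriumFastWindowLD.Negative.ConservedWindowSums

/-!
# The radial tail dominator — stub `stub_radialTailDominator` (S8) of line `Sketch`,
# crux `KineticCurrentsLDAlongFamilies` (stmt-AtomisticToContinuum-16659)

Route `OneFlightGossipEngine`, sub-problem `HydrodynamicLimit`. STATIC Gaussian analysis (no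
dynamics). For temperature/velocity bounds `(Θ, U)` (`Θ⁻¹ ≤ θ₀ ≤ Θ`, `‖u₀‖ ≤ U`) there are
`C_K = 4Θ(1+U²) + 1`, `L = 4Θ` such that for every `κ > 0` there is a level `V = 2ΘV₀ + 2U² ≥ 1`
with: for every continuous profile pair `(θ₀, u₀)` within the bounds the continuous radial weight
`K(x, ρ) = k(ρ / θ₀(x))`,
`k(r) = max 0 (r − V₀) − α − β r`, `α = (5m₀ − m₁)/2`, `β = (m₁ − 3m₀)/6`,
`m₀ = E_γ[max 0 (‖ξ‖² − V₀)]`, `m₁ = E_γ[max 0 (‖ξ‖² − V₀) ‖ξ‖²]` (`γ` the standard Gaussian on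
`ℝ³`), has a functional `K(x, ‖v − u₀(x)‖²)` of growth `C_K (1 + ‖v‖²)`, EXACTLY orthogonal to the
collision invariants `1, v_j, ‖v‖²` under the local Maxwellian `M_{1,u₀(x),θ₀(x)}` at every `x`
(in the reduced variable `v = u₀ + √θ₀ ξ` the functional is `k(‖ξ‖²)`, independent of the profile;
`E 1 = 1`, `E‖ξ‖² = 3`, `E‖ξ‖⁴ = 15` give `E k = m₀ − α − 3β = 0`,
`E[k ‖ξ‖²] = m₁ − 3α − 15β = 0`, and `E[k ξ_j] = 0` by oddness), and dominating the suprathermal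
kinetic energy: `0 ≤ K + κ`, `max 0 (‖v‖² − V) ≤ L (K + κ)`. The coefficients are small because
`V₀ (m₀ + m₁) → 0` as `V₀ → ∞` (dominated convergence against `‖ξ‖⁴`, `‖ξ‖⁶`).

Toolkit: `…KineticCurrentsWindowLDUniformClassTruncation{Gauss,Reduced}` (reduced variable,
Gaussian integrability by quadratic growth), `KineticFluxLdDecay/Negative/TiltBasics` (odd
integrands), `Literature.Probability.Distributions.GaussianCoordinateMoments` (`E‖ξ‖⁴`).
-/

noncomputable section

open MeasureTheory Set Filter ProbabilityTheory
open scoped ENNReal Topology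

namespace Summit.AtomisticToContinuum.HydrodynamicLimit.Theorems.KineticCurrentsLDAlongFamiliesSketch

open Literature.Analysis.FluidPDE (HardSphereFlow Config localMaxwellian)
open Literature.MathematicalPhysics.KineticTheory (T3 V3 hsDiameter localGibbsLaw)
open Literature.Analysis.FluidPDE Literature.MathematicalPhysics.KineticTheory
open KineticCurrentsWindowLDUniformSketch.ClassTruncation (integrable_of_le_lin
  integral_mul_localMaxwellian_shift norm_shift_sq_eq)
open KineticFluxLdDecayTilt (integral_eq_zero_of_odd_stdGaussian)

/-! ### Elementary inequalities for the tail profile `max 0 (r − V₀)` -/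

/-- `V · max 0 (s − V) ≤ s²` for `V, s ≥ 0`. [folklore] -/
theorem rtd_mul_tail_le {V s : ℝ} (hV : 0 ≤ V) (hs : 0 ≤ s) : V * max 0 (s - V) ≤ s ^ 2 := by
  rcases le_total (s - V) 0 with h | h
  · rw [max_eq_left h, mul_zero]; positivity
  · rw [max_eq_right h]; nlinarith [sq_nonneg (s - V), mul_nonneg hV hs]

/-- `V · (max 0 (s − V) · s) ≤ s³` for `V, s ≥ 0`. [folklore] -/
theorem rtd_mul_tail_mul_le {V s : ℝ} (hV : 0 ≤ V) (hs : 0 ≤ s) :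
    V * (max 0 (s - V) * s) ≤ s ^ 3 := by
  have h := mul_le_mul_of_nonneg_right (rtd_mul_tail_le hV hs) hs
  calc V * (max 0 (s - V) * s) = V * max 0 (s - V) * s := by ring
    _ ≤ s ^ 2 * s := h
    _ = s ^ 3 := by ring

/-- The re-orthogonalised profile has linear growth: `|max 0 (r − V₀) − α − β r| ≤ 2 (1 + r)` for
`r, V₀ ≥ 0`, `|α| ≤ 1`, `|β| ≤ 1/2`. [folklore] -/
theorem rtd_abs_profile_le {r V₀ α β : ℝ} (hV : 0 ≤ V₀) (hr : 0 ≤ r) (hα : |α| ≤ 1)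
    (hβ : |β| ≤ 1 / 2) : |max 0 (r - V₀) - α - β * r| ≤ 2 * (1 + r) := by
  have ht0 : 0 ≤ max 0 (r - V₀) := le_max_left _ _
  have ht : max 0 (r - V₀) ≤ r := max_le hr (by linarith)
  obtain ⟨hα1, hα2⟩ := abs_le.1 hα
  obtain ⟨hβ1, hβ2⟩ := abs_le.1 hβ
  have h1 : 0 ≤ (1 / 2 - β) * r := mul_nonneg (by linarith) hr
  have h2 : 0 ≤ (β + 1 / 2) * r := mul_nonneg (by linarith) hr
  exact abs_le.2 ⟨by linarith, by linarith⟩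

/-- Domination of the tail by the re-orthogonalised profile: if `|β| ≤ 1/2` and
`2|α| + 2|β| V₀ ≤ κ` then `max 0 (r − V₀) ≤ 2 (max 0 (r − V₀) − α − β r) + κ` for `r ≥ 0`
(use `r ≤ max 0 (r − V₀) + V₀`). [folklore] -/
theorem rtd_tail_le_profile {r V₀ α β κ : ℝ} (hr : 0 ≤ r) (hβ : |β| ≤ 1 / 2)
    (hc : 2 * |α| + 2 * |β| * V₀ ≤ κ) :
    max 0 (r - V₀) ≤ 2 * (max 0 (r - V₀) - α - β * r) + κ := by
  have ht0 : 0 ≤ max 0 (r - V₀) := le_max_left _ _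
  have hrt : r ≤ max 0 (r - V₀) + V₀ := by linarith [le_max_right 0 (r - V₀)]
  have h1 : β * r ≤ |β| * r := mul_le_mul_of_nonneg_right (le_abs_self β) hr
  have h2 : |β| * r ≤ |β| * (max 0 (r - V₀) + V₀) :=
    mul_le_mul_of_nonneg_left hrt (abs_nonneg β)
  have h3 : |β| * max 0 (r - V₀) ≤ max 0 (r - V₀) / 2 := by nlinarith [abs_nonneg β]
  linarith [le_abs_self α]

/-- Suprathermal kinetic energy versus the radial tail: with `V = 2ΘV₀ + 2U²`, `‖u‖ ≤ U` and
`0 < θ ≤ Θ`, `max 0 (‖v‖² − V) ≤ 2Θ · max 0 (‖v − u‖²/θ − V₀)`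
(`‖v‖² ≤ 2‖v − u‖² + 2U²`, `‖v − u‖² = θ r ≤ Θ r`). [folklore] -/
theorem rtd_energy_tail_le {Θ θ V₀ U : ℝ} (hθ : 0 < θ) (hθΘ : θ ≤ Θ) (v u : V3)
    (hu : ‖u‖ ≤ U) :
    max 0 (‖v‖ ^ 2 - (2 * Θ * V₀ + 2 * U ^ 2)) ≤ 2 * Θ * max 0 (‖v - u‖ ^ 2 / θ - V₀) := by
  have hΘ : 0 ≤ Θ := hθ.le.trans hθΘ
  have hvu : ‖v‖ ≤ ‖v - u‖ + ‖u‖ := by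
    calc ‖v‖ = ‖(v - u) + u‖ := by rw [sub_add_cancel]
      _ ≤ ‖v - u‖ + ‖u‖ := norm_add_le _ _
  have hsq1 : ‖v‖ ^ 2 ≤ (‖v - u‖ + ‖u‖) ^ 2 := pow_le_pow_left₀ (norm_nonneg _) hvu 2
  have hsq2 : ‖u‖ ^ 2 ≤ U ^ 2 := pow_le_pow_left₀ (norm_nonneg _) hu 2
  have hv2 : ‖v‖ ^ 2 ≤ 2 * ‖v - u‖ ^ 2 + 2 * U ^ 2 := by
    nlinarith [sq_nonneg (‖v - u‖ - ‖u‖)]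
  set r := ‖v - u‖ ^ 2 / θ with hr
  have hr0 : 0 ≤ r := div_nonneg (sq_nonneg _) hθ.le
  have hρ : ‖v - u‖ ^ 2 = θ * r := by rw [hr, mul_div_cancel₀ _ hθ.ne']
  rw [hρ] at hv2
  refine max_le (mul_nonneg (by positivity) (le_max_left _ _)) ?_
  have h3 : θ * r ≤ Θ * r := mul_le_mul_of_nonneg_right hθΘ hr0
  have h4 : Θ * (r - V₀) ≤ Θ * max 0 (r - V₀) :=
    mul_le_mul_of_nonneg_left (le_max_right _ _) hΘ
  linarith

/-! ### Gaussian tail moments `m₀(V) = E max 0 (‖ξ‖² − V)`, `m₁(V) = E[max 0 (‖ξ‖² − V) ‖ξ‖²]` -/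

/-- `‖ξ‖⁶` is integrable under the standard Gaussian on `ℝ³` (Fernique). [folklore] -/
theorem rtd_integrable_norm_pow_six :
    Integrable (fun ξ : V3 => ‖ξ‖ ^ 6) (stdGaussian V3) :=
  (IsGaussian.memLp_id _ 6 (by simp)).integrable_norm_pow (by norm_num)

/-- The tail `max 0 (‖ξ‖² − V)` (`V ≥ 0`) is Gaussian-integrable against `1, ξ_j, ‖ξ‖²`.
[folklore] -/
theorem rtd_integrable_tail {V : ℝ} (hV : 0 ≤ V) :
    Integrable (fun ξ : V3 => max 0 (‖ξ‖ ^ 2 - V)) (stdGaussian V3) ∧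
      (∀ j, Integrable (fun ξ : V3 => max 0 (‖ξ‖ ^ 2 - V) * ξ j) (stdGaussian V3)) ∧
      Integrable (fun ξ : V3 => max 0 (‖ξ‖ ^ 2 - V) * ‖ξ‖ ^ 2) (stdGaussian V3) :=
  integrable_of_le_lin (h := fun ξ : V3 => max 0 (‖ξ‖ ^ 2 - V)) (by fun_prop) (K := 1)
    fun ξ => by
      rw [abs_of_nonneg (le_max_left _ _), one_mul]
      exact max_le (by positivity) (by linarith [sq_nonneg ‖ξ‖])

/-- `V · m₀(V) → 0` as `V → ∞` (dominated convergence against `‖ξ‖⁴`). [folklore] -/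
theorem rtd_tendsto_mul_tail :
    Tendsto (fun V : ℝ => V * ∫ ξ, max 0 (‖ξ‖ ^ 2 - V) ∂stdGaussian V3) atTop (𝓝 0) := by
  have h := tendsto_integral_filter_of_dominated_convergence (μ := stdGaussian V3) (l := atTop)
    (F := fun (V : ℝ) (ξ : V3) => V * max 0 (‖ξ‖ ^ 2 - V)) (f := fun _ => (0 : ℝ))
    (fun ξ => ‖ξ‖ ^ 4)
    (Eventually.of_forall fun V =>
      (by fun_prop : Continuous fun ξ : V3 => V * max 0 (‖ξ‖ ^ 2 - V)).aestronglyMeasurable)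
    (by
      filter_upwards [eventually_ge_atTop 0] with V hV
      refine ae_of_all _ fun ξ => ?_
      rw [Real.norm_eq_abs, abs_of_nonneg (mul_nonneg hV (le_max_left _ _))]
      calc V * max 0 (‖ξ‖ ^ 2 - V) ≤ (‖ξ‖ ^ 2) ^ 2 := rtd_mul_tail_le hV (sq_nonneg _)
        _ = ‖ξ‖ ^ 4 := by ring)
    integrable_norm_pow_four_stdGaussian
    (ae_of_all _ fun ξ => tendsto_const_nhds.congr' (by
      filter_upwards [eventually_ge_atTop (‖ξ‖ ^ 2)] with V hV
      rw [max_eq_left (sub_nonpos.2 hV), mul_zero]))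
  simp only [integral_zero] at h
  exact h.congr fun V => integral_const_mul _ _

/-- `V · m₁(V) → 0` as `V → ∞` (dominated convergence against `‖ξ‖⁶`). [folklore] -/
theorem rtd_tendsto_mul_tail_mul :
    Tendsto (fun V : ℝ => V * ∫ ξ, max 0 (‖ξ‖ ^ 2 - V) * ‖ξ‖ ^ 2 ∂stdGaussian V3)
      atTop (𝓝 0) := by
  have h := tendsto_integral_filter_of_dominated_convergence (μ := stdGaussian V3) (l := atTop)
    (F := fun (V : ℝ) (ξ : V3) => V * (max 0 (‖ξ‖ ^ 2 - V) * ‖ξ‖ ^ 2)) (f := fun _ => (0 : ℝ))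
    (fun ξ => ‖ξ‖ ^ 6)
    (Eventually.of_forall fun V =>
      (by fun_prop : Continuous fun ξ : V3 =>
        V * (max 0 (‖ξ‖ ^ 2 - V) * ‖ξ‖ ^ 2)).aestronglyMeasurable)
    (by
      filter_upwards [eventually_ge_atTop 0] with V hV
      refine ae_of_all _ fun ξ => ?_
      rw [Real.norm_eq_abs,
        abs_of_nonneg (mul_nonneg hV (mul_nonneg (le_max_left _ _) (sq_nonneg _)))]
      calc V * (max 0 (‖ξ‖ ^ 2 - V) * ‖ξ‖ ^ 2) ≤ (‖ξ‖ ^ 2) ^ 3 :=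
            rtd_mul_tail_mul_le hV (sq_nonneg _)
        _ = ‖ξ‖ ^ 6 := by ring)
    rtd_integrable_norm_pow_six
    (ae_of_all _ fun ξ => tendsto_const_nhds.congr' (by
      filter_upwards [eventually_ge_atTop (‖ξ‖ ^ 2)] with V hV
      rw [max_eq_left (sub_nonpos.2 hV), zero_mul, mul_zero]))
  simp only [integral_zero] at h
  exact h.congr fun V => integral_const_mul _ _

/-- A level `V₀ ≥ 1` beyond which both weighted tail moments `V₀ m₀(V₀)`, `V₀ m₁(V₀)` are `≤ ε`.
[folklore] -/
theorem rtd_exists_level {ε : ℝ} (hε : 0 < ε) :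
    ∃ V₀ : ℝ, 1 ≤ V₀ ∧ V₀ * ∫ ξ, max 0 (‖ξ‖ ^ 2 - V₀) ∂stdGaussian V3 ≤ ε ∧
      V₀ * ∫ ξ, max 0 (‖ξ‖ ^ 2 - V₀) * ‖ξ‖ ^ 2 ∂stdGaussian V3 ≤ ε := by
  obtain ⟨V₀, h1, h2, h3⟩ := ((eventually_ge_atTop (1 : ℝ)).and
    ((rtd_tendsto_mul_tail.eventually (ge_mem_nhds hε)).and
      (rtd_tendsto_mul_tail_mul.eventually (ge_mem_nhds hε)))).exists
  exact ⟨V₀, h1, h2, h3⟩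

/-! ### Reduced orthogonality of the profile `k(‖ξ‖²)` to `1, ξ_j, ‖ξ‖²` -/

/-- **Gaussian re-orthogonalisation.** With `m₀ = E max 0 (‖ξ‖² − V₀)`,
`m₁ = E[max 0 (‖ξ‖² − V₀) ‖ξ‖²]`, `α = (5m₀ − m₁)/2`, `β = (m₁ − 3m₀)/6` and
`k(r) = max 0 (r − V₀) − α − β r`: `E k(‖ξ‖²) = m₀ − α − 3β = 0`,
`E[k(‖ξ‖²) ‖ξ‖²] = m₁ − 3α − 15β = 0` (`E‖ξ‖² = 3`, `E‖ξ‖⁴ = 15`), and `E[k(‖ξ‖²) ξ_j] = 0`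
by oddness. [folklore] -/
theorem rtd_gauss_orth {V₀ m₀ m₁ α β : ℝ} (hV : 0 ≤ V₀)
    (hm₀ : m₀ = ∫ ξ, max 0 (‖ξ‖ ^ 2 - V₀) ∂stdGaussian V3)
    (hm₁ : m₁ = ∫ ξ, max 0 (‖ξ‖ ^ 2 - V₀) * ‖ξ‖ ^ 2 ∂stdGaussian V3)
    (hα : α = (5 * m₀ - m₁) / 2) (hβ : β = (m₁ - 3 * m₀) / 6) {k : ℝ → ℝ}
    (hk : ∀ r, k r = max 0 (r - V₀) - α - β * r) :
    (∫ ξ, k (‖ξ‖ ^ 2) ∂stdGaussian V3 = 0) ∧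
      (∀ j, ∫ ξ, k (‖ξ‖ ^ 2) * ξ j ∂stdGaussian V3 = 0) ∧
      ∫ ξ, k (‖ξ‖ ^ 2) * ‖ξ‖ ^ 2 ∂stdGaussian V3 = 0 := by
  obtain ⟨hi0, -, hi2⟩ := rtd_integrable_tail hV
  have hE2 : ∫ ξ, ‖ξ‖ ^ 2 ∂stdGaussian V3 = 3 := by
    rw [integral_norm_sq_stdGaussian]; simp
  have hE4 : ∫ ξ, ‖ξ‖ ^ 4 ∂stdGaussian V3 = 15 := by
    rw [Literature.Probability.Distributions.integral_norm_pow_four_stdGaussian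
      (EuclideanSpace.basisFun (Fin 3) ℝ)]
    norm_num
  refine ⟨?_, fun j => ?_, ?_⟩
  · simp_rw [hk]
    have hA : Integrable (fun ξ : V3 => max 0 (‖ξ‖ ^ 2 - V₀) - α) (stdGaussian V3) :=
      hi0.sub (integrable_const α)
    rw [integral_sub hA (integrable_norm_sq_stdGaussian.const_mul β),
      integral_sub hi0 (integrable_const α), integral_const, integral_const_mul, hE2, ← hm₀,
      probReal_univ, one_smul, hα, hβ]
    ring
  · refine integral_eq_zero_of_odd_stdGaussian fun ξ => ?_
    simp only [norm_neg, PiLp.neg_apply, mul_neg]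
  · simp_rw [hk]
    have e : ∀ ξ : V3, (max 0 (‖ξ‖ ^ 2 - V₀) - α - β * ‖ξ‖ ^ 2) * ‖ξ‖ ^ 2 =
        max 0 (‖ξ‖ ^ 2 - V₀) * ‖ξ‖ ^ 2 - α * ‖ξ‖ ^ 2 - β * ‖ξ‖ ^ 4 := fun ξ => by ring
    simp_rw [e]
    have hB : Integrable (fun ξ : V3 => max 0 (‖ξ‖ ^ 2 - V₀) * ‖ξ‖ ^ 2 - α * ‖ξ‖ ^ 2)
        (stdGaussian V3) := hi2.sub (integrable_norm_sq_stdGaussian.const_mul α)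
    rw [integral_sub hB (integrable_norm_pow_four_stdGaussian.const_mul β),
      integral_sub hi2 (integrable_norm_sq_stdGaussian.const_mul α), integral_const_mul,
      integral_const_mul, hE2, hE4, ← hm₁, hα, hβ]
    ring

/-! ### From reduced orthogonality to Maxwellian orthogonality (quadratic growth) -/

/-- **Maxwellian orthogonality of a radial functional.** If the continuous profile `k` has linear
growth and `k(‖ξ‖²) ⊥ 1, ξ_j, ‖ξ‖²` in `L²(γ)`, then for `θ > 0`, `u ∈ ℝ³` the radial functional
`v ↦ k(‖v − u‖²/θ)` is orthogonal to `1, v_j, ‖v‖²` under `M_{1,u,θ}(v) dv`: in the reduced variable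
`v = u + √θ ξ` it is `k(‖ξ‖²)`, and `v_j = u_j + √θ ξ_j`,
`‖v‖² = ‖u‖² + 2√θ (u·ξ) + θ‖ξ‖²` (quadratic-growth version of
`ClassTruncation.maxwellian_orth_of_gauss_orth`). [folklore] -/
theorem rtd_maxwellian_orth_radial {k : ℝ → ℝ} (hkc : Continuous k) {C : ℝ}
    (hC : ∀ s, 0 ≤ s → |k s| ≤ C * (1 + s))
    (h0 : ∫ ξ, k (‖ξ‖ ^ 2) ∂stdGaussian V3 = 0)
    (h1 : ∀ j, ∫ ξ, k (‖ξ‖ ^ 2) * ξ j ∂stdGaussian V3 = 0)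
    (h2 : ∫ ξ, k (‖ξ‖ ^ 2) * ‖ξ‖ ^ 2 ∂stdGaussian V3 = 0) {θ : ℝ} (hθ : 0 < θ) (u : V3) :
    (∫ v, k (‖v - u‖ ^ 2 / θ) * localMaxwellian 1 θ u v = 0) ∧
      (∀ j, ∫ v, k (‖v - u‖ ^ 2 / θ) * v j * localMaxwellian 1 θ u v = 0) ∧
      ∫ v, k (‖v - u‖ ^ 2 / θ) * ‖v‖ ^ 2 * localMaxwellian 1 θ u v = 0 := by
  have hred : ∀ ξ : V3, ‖u + Real.sqrt θ • ξ - u‖ ^ 2 / θ = ‖ξ‖ ^ 2 := fun ξ => by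
    rw [add_sub_cancel_left, norm_smul, mul_pow, Real.norm_eq_abs, sq_abs, Real.sq_sqrt hθ.le,
      mul_div_cancel_left₀ _ hθ.ne']
  obtain ⟨hi0, hi1, hi2⟩ := integrable_of_le_lin (h := fun ξ : V3 => k (‖ξ‖ ^ 2))
    (by fun_prop) (K := C) fun ξ => hC _ (sq_nonneg _)
  refine ⟨?_, fun j => ?_, ?_⟩
  · rw [integral_mul_localMaxwellian_shift hθ u (fun v => k (‖v - u‖ ^ 2 / θ))]
    simp only [hred]
    exact h0
  · rw [integral_mul_localMaxwellian_shift hθ u (fun v => k (‖v - u‖ ^ 2 / θ) * v j)]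
    simp only [hred, PiLp.add_apply, PiLp.smul_apply, smul_eq_mul]
    have e : (fun ξ : V3 => k (‖ξ‖ ^ 2) * (u j + Real.sqrt θ * ξ j)) = fun ξ =>
        u j * k (‖ξ‖ ^ 2) + Real.sqrt θ * (k (‖ξ‖ ^ 2) * ξ j) := by
      funext ξ; ring
    rw [e, integral_add (hi0.const_mul _) ((hi1 j).const_mul _), integral_const_mul,
      integral_const_mul, h0, h1 j, mul_zero, mul_zero, add_zero]
  · rw [integral_mul_localMaxwellian_shift hθ u (fun v => k (‖v - u‖ ^ 2 / θ) * ‖v‖ ^ 2)]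
    simp only [hred]
    simp only [norm_shift_sq_eq hθ.le]
    have e : (fun ξ : V3 => k (‖ξ‖ ^ 2) *
        (‖u‖ ^ 2 + 2 * Real.sqrt θ * (∑ j, u j * ξ j) + θ * ‖ξ‖ ^ 2)) = fun ξ =>
        ‖u‖ ^ 2 * k (‖ξ‖ ^ 2) +
          2 * Real.sqrt θ * (∑ j, u j * (k (‖ξ‖ ^ 2) * ξ j)) +
          θ * (k (‖ξ‖ ^ 2) * ‖ξ‖ ^ 2) := by
      funext ξ; simp only [Fin.sum_univ_three]; ring
    have his : Integrable (fun ξ : V3 => ∑ j, u j * (k (‖ξ‖ ^ 2) * ξ j)) (stdGaussian V3) :=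
      integrable_finsetSum _ fun j _ => (hi1 j).const_mul _
    have hA : Integrable (fun ξ : V3 => ‖u‖ ^ 2 * k (‖ξ‖ ^ 2) +
        2 * Real.sqrt θ * (∑ j, u j * (k (‖ξ‖ ^ 2) * ξ j))) (stdGaussian V3) :=
      (hi0.const_mul _).add (his.const_mul _)
    rw [e, integral_add hA (hi2.const_mul _), integral_add (hi0.const_mul _) (his.const_mul _),
      integral_const_mul, integral_const_mul, integral_const_mul,
      integral_finsetSum _ fun j _ => (hi1 j).const_mul _]
    simp [integral_const_mul, h0, h1, h2]

/-! ### The stub -/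

/-- **Registered stub `stub_radialTailDominator`** (S8 of line `Sketch`, crux
stmt-AtomisticToContinuum-16659; STATIC). For temperature/velocity bounds `(Θ, U)` there are
`C_K, L ≥ 0` such that for every `κ > 0` there is a level `V ≥ 1` with: for every continuous
`(θ₀, u₀)` within the bounds there is a continuous radial weight `K` whose functional
`K(x, ‖v − u₀(x)‖²)` has growth `C_K(1+‖v‖²)`, is orthogonal to `1, v_j, ‖v‖²` under
`M_{1,u₀(x),θ₀(x)}` at every `x`, and dominates the suprathermal energy:
`0 ≤ K + κ` and `max 0 (‖v‖² − V) ≤ L (K + κ)`. Construction: `K(x,ρ) = k(ρ/θ₀(x))`,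
`k(r) = max 0 (r − V₀) − α − β r` with `α = (5m₀ − m₁)/2`, `β = (m₁ − 3m₀)/6`,
`m₀ = E_γ[max 0 (‖ξ‖² − V₀)]`, `m₁ = E_γ[max 0 (‖ξ‖² − V₀)‖ξ‖²]`, `V₀ (m₀ + m₁)` small
(`rtd_exists_level`), `L = 4Θ`, `V = 2ΘV₀ + 2U²`, `C_K = 4Θ(1+U²) + 1`. [folklore] -/
theorem stub_radialTailDominator :
    ∀ (Θ U : ℝ), 1 ≤ Θ → 0 ≤ U → ∃ CK L : ℝ, 0 ≤ CK ∧ 0 ≤ L ∧ ∀ κ : ℝ, 0 < κ →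
        ∃ V : ℝ, 1 ≤ V ∧ ∀ (θ₀ : T3 → ℝ) (u₀ : T3 → V3), Continuous θ₀ → Continuous u₀ →
        (∀ x, Θ⁻¹ ≤ θ₀ x ∧ θ₀ x ≤ Θ) → (∀ x, ‖u₀ x‖ ≤ U) →
        ∃ K : T3 × ℝ → ℝ, Continuous K ∧
        (∀ (x : T3) (v : V3), |K (x, ‖v - u₀ x‖ ^ 2)| ≤ CK * (1 + ‖v‖ ^ 2)) ∧
        (∀ x, ∫ v, K (x, ‖v - u₀ x‖ ^ 2) * localMaxwellian 1 (θ₀ x) (u₀ x) v = 0) ∧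
        (∀ x (j : Fin 3), ∫ v, K (x, ‖v - u₀ x‖ ^ 2) * v j * localMaxwellian 1 (θ₀ x) (u₀ x) v = 0) ∧
        (∀ x, ∫ v, K (x, ‖v - u₀ x‖ ^ 2) * ‖v‖ ^ 2 * localMaxwellian 1 (θ₀ x) (u₀ x) v = 0) ∧
        (∀ (x : T3) (v : V3), 0 ≤ K (x, ‖v - u₀ x‖ ^ 2) + κ) ∧
        ∀ (x : T3) (v : V3), max 0 (‖v‖ ^ 2 - V) ≤ L * (K (x, ‖v - u₀ x‖ ^ 2) + κ) := by
  intro Θ U hΘ hU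
  have hΘ0 : 0 < Θ := by linarith
  refine ⟨4 * Θ * (1 + U ^ 2) + 1, 4 * Θ, by positivity, by positivity, fun κ hκ => ?_⟩
  -- the level `V₀` and the Gaussian tail moments `m₀`, `m₁`
  obtain ⟨V₀, hV₀, hp₀, hp₁⟩ := rtd_exists_level (ε := min 1 κ / 16) (by positivity)
  have hV₀0 : 0 ≤ V₀ := by linarith
  set m₀ := ∫ ξ, max 0 (‖ξ‖ ^ 2 - V₀) ∂stdGaussian V3 with hm₀
  set m₁ := ∫ ξ, max 0 (‖ξ‖ ^ 2 - V₀) * ‖ξ‖ ^ 2 ∂stdGaussian V3 with hm₁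
  have hm₀0 : 0 ≤ m₀ := integral_nonneg fun ξ => le_max_left _ _
  have hm₁0 : 0 ≤ m₁ := integral_nonneg fun ξ => mul_nonneg (le_max_left _ _) (sq_nonneg _)
  have hε1 : min 1 κ / 16 ≤ 1 / 16 := by gcongr; exact min_le_left _ _
  have hεκ : min 1 κ / 16 ≤ κ / 16 := by gcongr; exact min_le_right _ _
  have hm₀' : m₀ ≤ V₀ * m₀ := le_mul_of_one_le_left hm₀0 hV₀
  have hm₁' : m₁ ≤ V₀ * m₁ := le_mul_of_one_le_left hm₁0 hV₀
  -- the re-orthogonalisation coefficients and their smallness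
  set α := (5 * m₀ - m₁) / 2 with hα
  set β := (m₁ - 3 * m₀) / 6 with hβ
  have hα1 : |α| ≤ 1 := abs_le.2 ⟨by linarith, by linarith⟩
  have hβ1 : |β| ≤ 1 / 2 := abs_le.2 ⟨by linarith, by linarith⟩
  have hc : 2 * |α| + 2 * |β| * V₀ ≤ κ := by
    have h1 : |α| ≤ 3 * (min 1 κ / 16) := abs_le.2 ⟨by linarith, by linarith⟩
    have h2 : |β| * V₀ ≤ min 1 κ / 16 := by
      have e : β * V₀ = (V₀ * m₁ - 3 * (V₀ * m₀)) / 6 := by rw [hβ]; ring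
      calc |β| * V₀ = |β * V₀| := by rw [abs_mul, abs_of_nonneg hV₀0]
        _ ≤ min 1 κ / 16 := by rw [e]; exact abs_le.2 ⟨by linarith, by linarith⟩
    linarith
  -- the profile `k` and its static properties
  obtain ⟨k, hk⟩ : ∃ k : ℝ → ℝ, ∀ r, k r = max 0 (r - V₀) - α - β * r := ⟨_, fun r => rfl⟩
  have hkc : Continuous k := by
    rw [show k = fun r => max 0 (r - V₀) - α - β * r from funext hk]
    fun_prop
  have hkb : ∀ s, 0 ≤ s → |k s| ≤ 2 * (1 + s) := fun s hs => by
    rw [hk]; exact rtd_abs_profile_le hV₀0 hs hα1 hβ1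
  obtain ⟨hg0, hg1, hg2⟩ := rtd_gauss_orth hV₀0 hm₀ hm₁ hα hβ hk
  -- the level `V`
  have hV1 : 1 ≤ 2 * Θ * V₀ + 2 * U ^ 2 := by
    nlinarith [mul_le_mul hΘ hV₀ zero_le_one hΘ0.le, sq_nonneg U]
  refine ⟨2 * Θ * V₀ + 2 * U ^ 2, hV1, fun θ₀ u₀ hθc _hu0c hθb hub => ?_⟩
  have hθpos : ∀ x, 0 < θ₀ x := fun x => (inv_pos.2 hΘ0).trans_le (hθb x).1
  have horth := fun x => rtd_maxwellian_orth_radial hkc hkb hg0 hg1 hg2 (hθpos x) (u₀ x)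
  refine ⟨fun p => k (p.2 / θ₀ p.1), ?_, ?_, fun x => (horth x).1, fun x j => (horth x).2.1 j,
    fun x => (horth x).2.2, ?_, ?_⟩
  · -- continuity
    exact hkc.comp (continuous_snd.div (hθc.comp continuous_fst) fun p => (hθpos p.1).ne')
  · -- quadratic growth
    intro x v
    show |k (‖v - u₀ x‖ ^ 2 / θ₀ x)| ≤ (4 * Θ * (1 + U ^ 2) + 1) * (1 + ‖v‖ ^ 2)
    have hr0 : 0 ≤ ‖v - u₀ x‖ ^ 2 / θ₀ x := div_nonneg (sq_nonneg _) (hθpos x).le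
    have hinv : (θ₀ x)⁻¹ ≤ Θ := inv_le_of_inv_le₀ hΘ0 (hθb x).1
    have hρ : ‖v - u₀ x‖ ^ 2 ≤ 2 * ‖v‖ ^ 2 + 2 * U ^ 2 := by
      have h1 : ‖v - u₀ x‖ ^ 2 ≤ (‖v‖ + ‖u₀ x‖) ^ 2 :=
        pow_le_pow_left₀ (norm_nonneg _) (norm_sub_le _ _) 2
      have h2 : ‖u₀ x‖ ^ 2 ≤ U ^ 2 := pow_le_pow_left₀ (norm_nonneg _) (hub x) 2
      nlinarith [sq_nonneg (‖v‖ - ‖u₀ x‖)]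
    have hr1 : ‖v - u₀ x‖ ^ 2 / θ₀ x ≤ Θ * (2 * ‖v‖ ^ 2 + 2 * U ^ 2) := by
      rw [div_eq_mul_inv]
      calc ‖v - u₀ x‖ ^ 2 * (θ₀ x)⁻¹ ≤ (2 * ‖v‖ ^ 2 + 2 * U ^ 2) * Θ :=
            mul_le_mul hρ hinv (inv_nonneg.2 (hθpos x).le) (by positivity)
        _ = Θ * (2 * ‖v‖ ^ 2 + 2 * U ^ 2) := mul_comm _ _
    calc |k (‖v - u₀ x‖ ^ 2 / θ₀ x)| ≤ 2 * (1 + ‖v - u₀ x‖ ^ 2 / θ₀ x) := hkb _ hr0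
      _ ≤ 2 * (1 + Θ * (2 * ‖v‖ ^ 2 + 2 * U ^ 2)) := by linarith
      _ ≤ (4 * Θ * (1 + U ^ 2) + 1) * (1 + ‖v‖ ^ 2) := by
          nlinarith [mul_nonneg (mul_nonneg hΘ0.le (sq_nonneg U)) (sq_nonneg ‖v‖),
            sq_nonneg ‖v‖]
  · -- `0 ≤ K + κ`
    intro x v
    show 0 ≤ k (‖v - u₀ x‖ ^ 2 / θ₀ x) + κ
    have hr0 : 0 ≤ ‖v - u₀ x‖ ^ 2 / θ₀ x := div_nonneg (sq_nonneg _) (hθpos x).le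
    have h1 := rtd_tail_le_profile hr0 hβ1 hc
    rw [hk]
    linarith [le_max_left 0 (‖v - u₀ x‖ ^ 2 / θ₀ x - V₀)]
  · -- domination of the suprathermal kinetic energy
    intro x v
    show max 0 (‖v‖ ^ 2 - (2 * Θ * V₀ + 2 * U ^ 2)) ≤
      4 * Θ * (k (‖v - u₀ x‖ ^ 2 / θ₀ x) + κ)
    have hr0 : 0 ≤ ‖v - u₀ x‖ ^ 2 / θ₀ x := div_nonneg (sq_nonneg _) (hθpos x).le
    have h1 := rtd_tail_le_profile hr0 hβ1 hc
    have h2 := rtd_energy_tail_le (Θ := Θ) (V₀ := V₀) (hθpos x) (hθb x).2 v (u₀ x) (hub x)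
    rw [hk]
    calc max 0 (‖v‖ ^ 2 - (2 * Θ * V₀ + 2 * U ^ 2))
        ≤ 2 * Θ * max 0 (‖v - u₀ x‖ ^ 2 / θ₀ x - V₀) := h2
      _ ≤ 2 * Θ * (2 * (max 0 (‖v - u₀ x‖ ^ 2 / θ₀ x - V₀) - α -
            β * (‖v - u₀ x‖ ^ 2 / θ₀ x)) + κ) :=
          mul_le_mul_of_nonneg_left h1 (by positivity)
      _ ≤ 4 * Θ * (max 0 (‖v - u₀ x‖ ^ 2 / θ₀ x - V₀) - α -
            β * (‖v - u₀ x‖ ^ 2 / θ₀ x) + κ) := by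
          nlinarith [mul_nonneg hΘ0.le hκ.le]

end Summit.AtomisticToContinuum.HydrodynamicLimit.Theorems.KineticCurrentsLDAlongFamiliesSketch

end
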